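import Summits.QuantumFields.YangMills.Theses.ToronCumulantSign
import Literature.MathematicalPhysics.QuantumLattice.StaggeredGaugeExpectationZeroCoupling

/-!
# Route `ToronCumulantSign` — the support `OneSiteCovAtZero` (stmt-QuantumFields-27532), PROVED

At `β = 0` the one-site (`L = 1`, Eguchi–Kawai) `SU(N)` Wilson measure is the product Haar probability measure on the four
links (`wilsonMeasure_zero`); the plaquette energy `Re tr U_(0;01)` is a (measurable) function of the links `0, 1` and
`Re tr U_(0;23)` of the links `2, 3` (`plaquetteHolonomy_oneSite`: `U_(x;ij) = U_i U_j U_i⁻¹ U_j⁻¹`), so the two are independent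
(`iIndepFun_pi` + `iIndepFun.indepFun_finset` + `IndepFun.comp`) and their covariance vanishes:
`complementaryPlaneCov N 1 0 = 0` for every `N ≥ 2` (indeed for every `N`).  No auxiliary definition is introduced.

HONEST LABEL: this is the trivial support of the line; the two cruxes (`CommutatorSkewMoment`, `OneSiteCovDerivative` — the Haar
moment computations) are OPEN and the barrier fact `ToronPlaneAnticorrelation` is NOT discharged here.  Nothing about the Yang–Mills
mass gap.

References: J. Ginibre, CMP 16 (1970) 310–328 [Ginibre1970]; S. Chatterjee, arXiv:1803.01950 (§2, the lattice set-up).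
-/

noncomputable section

open MeasureTheory ProbabilityTheory
open Literature.MathematicalPhysics.QuantumFieldTheory Literature.MathematicalPhysics.QuantumLattice
open Literature.Barriers.QuantumFields

namespace Summit.QuantumFields.YangMills.Theorems.ToronCumulantSign

/-- The link-pair energy `v ↦ Re tr (v_a v_b v_a⁻¹ v_b⁻¹)` on a finset of one-site links is continuous, hence measurable. [folklore] -/
theorem measurable_pairEnergy (N : ℕ) (S : Finset (Edge 4 1)) (a b : S) :
    Measurable (fun v : (e : S) → Matrix.specialUnitaryGroup (Fin N) ℂ =>
      (((v a * v b * (v a)⁻¹ * (v b)⁻¹ : Matrix.specialUnitaryGroup (Fin N) ℂ) : Matrix (Fin N) (Fin N) ℂ).trace).re) := by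
  haveI := secondCountableTopology_su N
  have hc : Continuous (fun v : (e : S) → Matrix.specialUnitaryGroup (Fin N) ℂ =>
      (((v a * v b * (v a)⁻¹ * (v b)⁻¹ : Matrix.specialUnitaryGroup (Fin N) ℂ) : Matrix (Fin N) (Fin N) ℂ).trace).re) := by
    have ha : Continuous fun v : (e : S) → Matrix.specialUnitaryGroup (Fin N) ℂ => v a := continuous_apply a
    have hb : Continuous fun v : (e : S) → Matrix.specialUnitaryGroup (Fin N) ℂ => v b := continuous_apply b
    have hprod : Continuous fun v : (e : S) → Matrix.specialUnitaryGroup (Fin N) ℂ => v a * v b * (v a)⁻¹ * (v b)⁻¹ :=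
      ((ha.mul hb).mul ha.inv).mul hb.inv
    exact Complex.continuous_re.comp ((continuous_id.matrix_trace).comp (continuous_subtype_val.comp hprod))
  exact hc.measurable

/-- On the one-site torus, the plaquette energy through the origin in the plane `(i,j)` is the link-pair energy read on any
finset of links containing `(0,i)` and `(0,j)`. [folklore] -/
theorem suPlaquetteReTrace_oneSite_eq (N : ℕ) (i j : Fin 4) (h : i < j) (S : Finset (Edge 4 1))
    (hi : ((0 : Site 4 1), i) ∈ S) (hj : ((0 : Site 4 1), j) ∈ S) :
    suPlaquetteReTrace N 1 (originPlaquette 1 i j h) =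
      (fun v : (e : S) → Matrix.specialUnitaryGroup (Fin N) ℂ =>
        (((v ⟨_, hi⟩ * v ⟨_, hj⟩ * (v ⟨_, hi⟩)⁻¹ * (v ⟨_, hj⟩)⁻¹ : Matrix.specialUnitaryGroup (Fin N) ℂ) :
          Matrix (Fin N) (Fin N) ℂ).trace).re) ∘
      fun (U : GaugeConfig 4 1 (Matrix.specialUnitaryGroup (Fin N) ℂ)) (e : S) => U e := by
  funext U
  rw [suPlaquetteReTrace_apply]
  simp only [originPlaquette, Function.comp_apply]
  rw [plaquetteHolonomy_oneSite]

/-- **Support `OneSiteCovAtZero` of route `ToronCumulantSign`** (stmt-QuantumFields-27532): at `β = 0` the complementary-plane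
one-site covariance vanishes, by independence of disjoint link pairs under the product Haar measure. -/
theorem oneSiteCovAtZero_proof : Summit.QuantumFields.YangMills.Theses.ToronCumulantSign.OneSiteCovAtZero := by
  intro N _hN
  haveI := secondCountableTopology_su N
  haveI : IsProbabilityMeasure (haarProbability (Matrix.specialUnitaryGroup (Fin N) ℂ)) :=
    ⟨by simpa [haarProbability] using Measure.haarMeasure_self (G := Matrix.specialUnitaryGroup (Fin N) ℂ) (K₀ := ⊤)⟩
  unfold complementaryPlaneCov
  rw [covariance_suPlaquetteReTrace_eq]
  -- at `β = 0` the Wilson measure is product Haar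
  have hμ : suWilsonMeasure N 1 0 =
      Measure.pi (fun _ : Edge 4 1 => haarProbability (Matrix.specialUnitaryGroup (Fin N) ℂ)) := by
    unfold suWilsonMeasure
    exact wilsonMeasure_zero _
  rw [hμ]
  -- the coordinates are independent under the product measure
  have hind : iIndepFun (fun (e : Edge 4 1) (U : GaugeConfig 4 1 (Matrix.specialUnitaryGroup (Fin N) ℂ)) => U e)
      (Measure.pi (fun _ : Edge 4 1 => haarProbability (Matrix.specialUnitaryGroup (Fin N) ℂ))) :=
    iIndepFun_pi (X := fun (_ : Edge 4 1) (g : Matrix.specialUnitaryGroup (Fin N) ℂ) => g) (fun _ => aemeasurable_id)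
  -- the two disjoint link pairs
  let S : Finset (Edge 4 1) := {((0 : Site 4 1), (0 : Fin 4)), ((0 : Site 4 1), (1 : Fin 4))}
  let T : Finset (Edge 4 1) := {((0 : Site 4 1), (2 : Fin 4)), ((0 : Site 4 1), (3 : Fin 4))}
  have hST : Disjoint S T := by decide
  have hS0 : ((0 : Site 4 1), (0 : Fin 4)) ∈ S := by simp [S]
  have hS1 : ((0 : Site 4 1), (1 : Fin 4)) ∈ S := by simp [S]
  have hT2 : ((0 : Site 4 1), (2 : Fin 4)) ∈ T := by simp [T]
  have hT3 : ((0 : Site 4 1), (3 : Fin 4)) ∈ T := by simp [T]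
  have hindST := hind.indepFun_finset S T hST (fun e => measurable_pi_apply e)
  have hfg := hindST.comp (measurable_pairEnergy N S ⟨_, hS0⟩ ⟨_, hS1⟩) (measurable_pairEnergy N T ⟨_, hT2⟩ ⟨_, hT3⟩)
  rw [suPlaquetteReTrace_oneSite_eq N 0 1 (by decide) S hS0 hS1, suPlaquetteReTrace_oneSite_eq N 2 3 (by decide) T hT2 hT3]
  -- integrability (bounded continuous on a probability space) and the product formula
  have hmeas : ∀ (R : Finset (Edge 4 1)) (a b : R), AEStronglyMeasurable
      ((fun v : (e : R) → Matrix.specialUnitaryGroup (Fin N) ℂ =>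
        (((v a * v b * (v a)⁻¹ * (v b)⁻¹ : Matrix.specialUnitaryGroup (Fin N) ℂ) : Matrix (Fin N) (Fin N) ℂ).trace).re) ∘
        fun (U : GaugeConfig 4 1 (Matrix.specialUnitaryGroup (Fin N) ℂ)) (e : R) => U e)
      (Measure.pi (fun _ : Edge 4 1 => haarProbability (Matrix.specialUnitaryGroup (Fin N) ℂ))) := fun R a b =>
    ((measurable_pairEnergy N R a b).comp (measurable_pi_lambda _ fun e => measurable_pi_apply (e : Edge 4 1))).aestronglyMeasurable
  have key := hfg.integral_fun_mul_eq_mul_integral (hmeas S _ _) (hmeas T _ _)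
  simp only [Function.comp_apply] at key ⊢
  rw [key]
  ring

end Summit.QuantumFields.YangMills.Theorems.ToronCumulantSign

end
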